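import Mathlib.Data.Real.Basic
import Mathlib.Tactic.NormNum
import Mathlib.Tactic.Linarith
import HarnessLib

/-!
# The three-point variance row `(3PT)` is independent, at law level, of the proved three-point bank

Support file for crux `stmt-CriticalPhenomena-4575` (`NoHeavyLowerTail`), seat `prim-l12-p1` gen 17
(`--supports stmt-CriticalPhenomena-4575`; memo `run/shared/lean/prim/prim-l12/FROM-prim-l12-p1-g17-GLADKOV-REGIME.md` §3).
Pure real arithmetic (one explicit rational point); no measure theory, no definitions, no named facts.

Cells of the partition of `{a,b,c}` induced by the clusters of bond percolation: `x = P(abc)`, `s = P(ab|c)`,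
`t = P(ac|b)`, `u = P(a|bc)`, `q = P(a|b|c)` (`x+s+t+u+q = 1`), `θ = P(a↔b) = x+s`.  The row under study is
`(3PT)  θ(1−θ) ≤ s+t+u` (tree: `…ThreePointVarianceLeFive`, `…ThreePointVarianceGladkovRegime`, …).

The PROVED three-point bank (valid on every finite weighted graph, all in the tree):
* Harris for the three connection events and their complements (12 products) [`prodBernoulli` Harris];
* Gladkov–Zimin Thm 4.6 `P(v isolated)·P(v joined) ≤ s+t+u` at each vertex `v` and its computer version with
  `−(two-cell)²` terms [cite: GladkovZimin2024, Thm. 4.6 and §5 (eq:computer)] (tree `gladkovZimin2024_threePoint_prodBernoulli`);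
* the Aas–Gladkov inequality `xq ≥ st+su+tu` [cite: Gladkov2024StrongFKG, Cor. 4.2] (tree `prodBernoulli_threePoint_strongHarris`);
* Gladkov's Lemma 1.2 `q²/P(y iso) + q²/P(z iso) ≤ q + P(x iso)²` at each vertex `x` [cite: Gladkov2024, Lemma 1.2]
  (tree `gladkov2024_lemma_1_2_prodBernoulli`).

THEOREM (`threePointVariance_not_implied_by_bank`): the simplex point
`(x,s,t,u,q) = (1691/2000, 1/100, 53/1000, 53/1000, 77/2000)` satisfies every inequality of the bank (all
vertex relabellings; each with margin `≥ 10⁻⁴`) and VIOLATES `(3PT)`: `θ(1−θ) − (s+t+u) = 30479/4000000 > 0`.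
Hence `(3PT)` is not a consequence of the bank by any argument that uses the law of one graph only through these
inequalities (in particular it lies outside the hypothesis of `…ThreePointVarianceGladkovRegime`, which there must
be supplied by the graph).  Whether this point is the law of a graph is exactly what `(3PT)` denies; nothing is
claimed about realizability.
-/

namespace Summit.CriticalPhenomena.PercolationContinuityZ3.Theorems.ThreePointVarianceLawLevelIndependence

/-- **`(3PT)` is not implied at law level by Harris + GZ Thm 4.6 (+ computer version) + Aas–Gladkov + Gladkov's
Lemma 1.2 (all relabellings).**  Explicit rational point of the simplex satisfying the bank and violating `(3PT)`.
In the statement `θ = x+s`, `α = P(a↔c) = x+t`, `β = P(b↔c) = x+u`; the isolation probabilities are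
`P(a iso) = q+u`, `P(b iso) = q+t`, `P(c iso) = q+s`. [this work] -/
theorem threePointVariance_not_implied_by_bank :
    ∃ x s t u q : ℝ, 0 ≤ x ∧ 0 ≤ s ∧ 0 ≤ t ∧ 0 ≤ u ∧ 0 ≤ q ∧ x + s + t + u + q = 1 ∧
      -- Harris (12 products): pairs of connection events / pairs of complements / mixed
      (x + s) * (x + t) ≤ x ∧ (x + s) * (x + u) ≤ x ∧ (x + t) * (x + u) ≤ x ∧
      (1 - (x + t)) * (1 - (x + u)) ≤ q + s ∧ (1 - (x + s)) * (1 - (x + t)) ≤ u + q ∧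
      (1 - (x + s)) * (1 - (x + u)) ≤ t + q ∧
      s ≤ (x + s) * (1 - (x + t)) ∧ s ≤ (x + s) * (1 - (x + u)) ∧ t ≤ (x + t) * (1 - (x + s)) ∧
      t ≤ (x + t) * (1 - (x + u)) ∧ u ≤ (x + u) * (1 - (x + s)) ∧ u ≤ (x + u) * (1 - (x + t)) ∧
      -- Gladkov–Zimin Thm 4.6 at the vertices a, b, c
      (u + q) * (x + s + t) ≤ s + t + u ∧ (t + q) * (x + s + u) ≤ s + t + u ∧ (s + q) * (x + t + u) ≤ s + t + u ∧
      -- its computer version (eq:computer) at a, b, c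
      (u + q) * (x + s + t) ≤ s + t + u - s ^ 2 - t ^ 2 ∧ (t + q) * (x + s + u) ≤ s + t + u - s ^ 2 - u ^ 2 ∧
      (s + q) * (x + t + u) ≤ s + t + u - t ^ 2 - u ^ 2 ∧
      -- Aas–Gladkov
      s * t + s * u + t * u ≤ x * q ∧
      -- Gladkov Lemma 1.2 at a, b, c
      q ^ 2 / (q + t) + q ^ 2 / (q + s) ≤ q + (q + u) ^ 2 ∧
      q ^ 2 / (q + u) + q ^ 2 / (q + s) ≤ q + (q + t) ^ 2 ∧
      q ^ 2 / (q + t) + q ^ 2 / (q + u) ≤ q + (q + s) ^ 2 ∧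
      -- … and `(3PT)` FAILS at the pair `ab`
      s + t + u < (x + s) * (1 - (x + s)) := by
  refine ⟨1691 / 2000, 1 / 100, 53 / 1000, 53 / 1000, 77 / 2000, ?_⟩
  norm_num

/-- The violation is quantitative: at the point above `θ(1−θ) − (s+t+u) = 30479/4000000 ≈ 7.6·10⁻³`. [this work] -/
theorem violation_value :
    ((1691 : ℝ) / 2000 + 1 / 100) * (1 - (1691 / 2000 + 1 / 100)) - (1 / 100 + 53 / 1000 + 53 / 1000) =
      30479 / 4000000 := by
  norm_num

end Summit.CriticalPhenomena.PercolationContinuityZ3.Theorems.ThreePointVarianceLawLevelIndependence
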